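import Summits.Ventures.PercRepro.RankLevelSetRuleQCell

/-!
# PercRepro — RULE Q AT THE TIGHT LAYER: THE CELL INEQUALITIES `RhatCell q k` BY KERNEL EVALUATION (RankLevelSetRuleQCellEvalW28Q6; night-1, gen 14)

Each theorem `rhatCell_q_k : RhatCell q k` (`∀ m ≤ q, Φ(q+k, q) ≤ R̂(q, k, m)`, RankLevelSetRuleQCell) is discharged by
`interval_cases m` and `norm_num` on the unfolded binomial sums (`Nat.choose` by its recursion; the
`Finset.Ioo`-sums as `Finset.range`-sums via `sum_Ioo_nat`). No `native_decide`, no `decide` on the rationals. With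
`hallUp_of_ncard_eq_of_rhatCell` each cell gives the UP form of C-044 at the tight layer `#E = (q+k) + q` of the cell
`(q+k, q)` for every finite matroid; the DOWN form is `hallDown_of_ncard_eq`. Cells: (6,13), (6,14), (6,15), (6,16).
Axioms: standard.
-/

namespace PercRepro

open Finset

/-- `Φ(19, 6) ≤ R̂(6, 13, 0)` (the cell `(19, 6)` at `#P = 0`), by kernel evaluation. -/
theorem rhatCell_6_13_0 : phiK (6 + 13) 6 ≤ rhat 6 13 0 := by
  simp only [rhat, phiK, mhat, sum_Ioo_nat]
  norm_num [Finset.sum_range_succ, Nat.choose, Nat.min_def]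

/-- `Φ(19, 6) ≤ R̂(6, 13, 1)` (the cell `(19, 6)` at `#P = 1`), by kernel evaluation. -/
theorem rhatCell_6_13_1 : phiK (6 + 13) 6 ≤ rhat 6 13 1 := by
  simp only [rhat, phiK, mhat, sum_Ioo_nat]
  norm_num [Finset.sum_range_succ, Nat.choose, Nat.min_def]

/-- `Φ(19, 6) ≤ R̂(6, 13, 2)` (the cell `(19, 6)` at `#P = 2`), by kernel evaluation. -/
theorem rhatCell_6_13_2 : phiK (6 + 13) 6 ≤ rhat 6 13 2 := by
  simp only [rhat, phiK, mhat, sum_Ioo_nat]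
  norm_num [Finset.sum_range_succ, Nat.choose, Nat.min_def]

/-- `Φ(19, 6) ≤ R̂(6, 13, 3)` (the cell `(19, 6)` at `#P = 3`), by kernel evaluation. -/
theorem rhatCell_6_13_3 : phiK (6 + 13) 6 ≤ rhat 6 13 3 := by
  simp only [rhat, phiK, mhat, sum_Ioo_nat]
  norm_num [Finset.sum_range_succ, Nat.choose, Nat.min_def]

/-- `Φ(19, 6) ≤ R̂(6, 13, 4)` (the cell `(19, 6)` at `#P = 4`), by kernel evaluation. -/
theorem rhatCell_6_13_4 : phiK (6 + 13) 6 ≤ rhat 6 13 4 := by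
  simp only [rhat, phiK, mhat, sum_Ioo_nat]
  norm_num [Finset.sum_range_succ, Nat.choose, Nat.min_def]

/-- `Φ(19, 6) ≤ R̂(6, 13, 5)` (the cell `(19, 6)` at `#P = 5`), by kernel evaluation. -/
theorem rhatCell_6_13_5 : phiK (6 + 13) 6 ≤ rhat 6 13 5 := by
  simp only [rhat, phiK, mhat, sum_Ioo_nat]
  norm_num [Finset.sum_range_succ, Nat.choose, Nat.min_def]

/-- `Φ(19, 6) ≤ R̂(6, 13, 6)` (the cell `(19, 6)` at `#P = 6`), by kernel evaluation. -/
theorem rhatCell_6_13_6 : phiK (6 + 13) 6 ≤ rhat 6 13 6 := by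
  simp only [rhat, phiK, mhat, sum_Ioo_nat]
  norm_num [Finset.sum_range_succ, Nat.choose, Nat.min_def]

/-- The cell `(19, 6)` (`q = 6`, `k = 13`): `Φ(19, 6) ≤ R̂(6, 13, m)` for every `m ≤ 6`. -/
theorem rhatCell_6_13 : RhatCell 6 13 := by
  intro m hm
  interval_cases m
  · exact rhatCell_6_13_0
  · exact rhatCell_6_13_1
  · exact rhatCell_6_13_2
  · exact rhatCell_6_13_3
  · exact rhatCell_6_13_4
  · exact rhatCell_6_13_5
  · exact rhatCell_6_13_6

/-- `Φ(20, 6) ≤ R̂(6, 14, 0)` (the cell `(20, 6)` at `#P = 0`), by kernel evaluation. -/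
theorem rhatCell_6_14_0 : phiK (6 + 14) 6 ≤ rhat 6 14 0 := by
  simp only [rhat, phiK, mhat, sum_Ioo_nat]
  norm_num [Finset.sum_range_succ, Nat.choose, Nat.min_def]

/-- `Φ(20, 6) ≤ R̂(6, 14, 1)` (the cell `(20, 6)` at `#P = 1`), by kernel evaluation. -/
theorem rhatCell_6_14_1 : phiK (6 + 14) 6 ≤ rhat 6 14 1 := by
  simp only [rhat, phiK, mhat, sum_Ioo_nat]
  norm_num [Finset.sum_range_succ, Nat.choose, Nat.min_def]

/-- `Φ(20, 6) ≤ R̂(6, 14, 2)` (the cell `(20, 6)` at `#P = 2`), by kernel evaluation. -/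
theorem rhatCell_6_14_2 : phiK (6 + 14) 6 ≤ rhat 6 14 2 := by
  simp only [rhat, phiK, mhat, sum_Ioo_nat]
  norm_num [Finset.sum_range_succ, Nat.choose, Nat.min_def]

/-- `Φ(20, 6) ≤ R̂(6, 14, 3)` (the cell `(20, 6)` at `#P = 3`), by kernel evaluation. -/
theorem rhatCell_6_14_3 : phiK (6 + 14) 6 ≤ rhat 6 14 3 := by
  simp only [rhat, phiK, mhat, sum_Ioo_nat]
  norm_num [Finset.sum_range_succ, Nat.choose, Nat.min_def]

/-- `Φ(20, 6) ≤ R̂(6, 14, 4)` (the cell `(20, 6)` at `#P = 4`), by kernel evaluation. -/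
theorem rhatCell_6_14_4 : phiK (6 + 14) 6 ≤ rhat 6 14 4 := by
  simp only [rhat, phiK, mhat, sum_Ioo_nat]
  norm_num [Finset.sum_range_succ, Nat.choose, Nat.min_def]

/-- `Φ(20, 6) ≤ R̂(6, 14, 5)` (the cell `(20, 6)` at `#P = 5`), by kernel evaluation. -/
theorem rhatCell_6_14_5 : phiK (6 + 14) 6 ≤ rhat 6 14 5 := by
  simp only [rhat, phiK, mhat, sum_Ioo_nat]
  norm_num [Finset.sum_range_succ, Nat.choose, Nat.min_def]

/-- `Φ(20, 6) ≤ R̂(6, 14, 6)` (the cell `(20, 6)` at `#P = 6`), by kernel evaluation. -/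
theorem rhatCell_6_14_6 : phiK (6 + 14) 6 ≤ rhat 6 14 6 := by
  simp only [rhat, phiK, mhat, sum_Ioo_nat]
  norm_num [Finset.sum_range_succ, Nat.choose, Nat.min_def]

/-- The cell `(20, 6)` (`q = 6`, `k = 14`): `Φ(20, 6) ≤ R̂(6, 14, m)` for every `m ≤ 6`. -/
theorem rhatCell_6_14 : RhatCell 6 14 := by
  intro m hm
  interval_cases m
  · exact rhatCell_6_14_0
  · exact rhatCell_6_14_1
  · exact rhatCell_6_14_2
  · exact rhatCell_6_14_3
  · exact rhatCell_6_14_4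
  · exact rhatCell_6_14_5
  · exact rhatCell_6_14_6

/-- `Φ(21, 6) ≤ R̂(6, 15, 0)` (the cell `(21, 6)` at `#P = 0`), by kernel evaluation. -/
theorem rhatCell_6_15_0 : phiK (6 + 15) 6 ≤ rhat 6 15 0 := by
  simp only [rhat, phiK, mhat, sum_Ioo_nat]
  norm_num [Finset.sum_range_succ, Nat.choose, Nat.min_def]

/-- `Φ(21, 6) ≤ R̂(6, 15, 1)` (the cell `(21, 6)` at `#P = 1`), by kernel evaluation. -/
theorem rhatCell_6_15_1 : phiK (6 + 15) 6 ≤ rhat 6 15 1 := by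
  simp only [rhat, phiK, mhat, sum_Ioo_nat]
  norm_num [Finset.sum_range_succ, Nat.choose, Nat.min_def]

/-- `Φ(21, 6) ≤ R̂(6, 15, 2)` (the cell `(21, 6)` at `#P = 2`), by kernel evaluation. -/
theorem rhatCell_6_15_2 : phiK (6 + 15) 6 ≤ rhat 6 15 2 := by
  simp only [rhat, phiK, mhat, sum_Ioo_nat]
  norm_num [Finset.sum_range_succ, Nat.choose, Nat.min_def]

/-- `Φ(21, 6) ≤ R̂(6, 15, 3)` (the cell `(21, 6)` at `#P = 3`), by kernel evaluation. -/
theorem rhatCell_6_15_3 : phiK (6 + 15) 6 ≤ rhat 6 15 3 := by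
  simp only [rhat, phiK, mhat, sum_Ioo_nat]
  norm_num [Finset.sum_range_succ, Nat.choose, Nat.min_def]

/-- `Φ(21, 6) ≤ R̂(6, 15, 4)` (the cell `(21, 6)` at `#P = 4`), by kernel evaluation. -/
theorem rhatCell_6_15_4 : phiK (6 + 15) 6 ≤ rhat 6 15 4 := by
  simp only [rhat, phiK, mhat, sum_Ioo_nat]
  norm_num [Finset.sum_range_succ, Nat.choose, Nat.min_def]

/-- `Φ(21, 6) ≤ R̂(6, 15, 5)` (the cell `(21, 6)` at `#P = 5`), by kernel evaluation. -/
theorem rhatCell_6_15_5 : phiK (6 + 15) 6 ≤ rhat 6 15 5 := by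
  simp only [rhat, phiK, mhat, sum_Ioo_nat]
  norm_num [Finset.sum_range_succ, Nat.choose, Nat.min_def]

/-- `Φ(21, 6) ≤ R̂(6, 15, 6)` (the cell `(21, 6)` at `#P = 6`), by kernel evaluation. -/
theorem rhatCell_6_15_6 : phiK (6 + 15) 6 ≤ rhat 6 15 6 := by
  simp only [rhat, phiK, mhat, sum_Ioo_nat]
  norm_num [Finset.sum_range_succ, Nat.choose, Nat.min_def]

/-- The cell `(21, 6)` (`q = 6`, `k = 15`): `Φ(21, 6) ≤ R̂(6, 15, m)` for every `m ≤ 6`. -/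
theorem rhatCell_6_15 : RhatCell 6 15 := by
  intro m hm
  interval_cases m
  · exact rhatCell_6_15_0
  · exact rhatCell_6_15_1
  · exact rhatCell_6_15_2
  · exact rhatCell_6_15_3
  · exact rhatCell_6_15_4
  · exact rhatCell_6_15_5
  · exact rhatCell_6_15_6

/-- `Φ(22, 6) ≤ R̂(6, 16, 0)` (the cell `(22, 6)` at `#P = 0`), by kernel evaluation. -/
theorem rhatCell_6_16_0 : phiK (6 + 16) 6 ≤ rhat 6 16 0 := by
  simp only [rhat, phiK, mhat, sum_Ioo_nat]
  norm_num [Finset.sum_range_succ, Nat.choose, Nat.min_def]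

/-- `Φ(22, 6) ≤ R̂(6, 16, 1)` (the cell `(22, 6)` at `#P = 1`), by kernel evaluation. -/
theorem rhatCell_6_16_1 : phiK (6 + 16) 6 ≤ rhat 6 16 1 := by
  simp only [rhat, phiK, mhat, sum_Ioo_nat]
  norm_num [Finset.sum_range_succ, Nat.choose, Nat.min_def]

/-- `Φ(22, 6) ≤ R̂(6, 16, 2)` (the cell `(22, 6)` at `#P = 2`), by kernel evaluation. -/
theorem rhatCell_6_16_2 : phiK (6 + 16) 6 ≤ rhat 6 16 2 := by
  simp only [rhat, phiK, mhat, sum_Ioo_nat]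
  norm_num [Finset.sum_range_succ, Nat.choose, Nat.min_def]

/-- `Φ(22, 6) ≤ R̂(6, 16, 3)` (the cell `(22, 6)` at `#P = 3`), by kernel evaluation. -/
theorem rhatCell_6_16_3 : phiK (6 + 16) 6 ≤ rhat 6 16 3 := by
  simp only [rhat, phiK, mhat, sum_Ioo_nat]
  norm_num [Finset.sum_range_succ, Nat.choose, Nat.min_def]

/-- `Φ(22, 6) ≤ R̂(6, 16, 4)` (the cell `(22, 6)` at `#P = 4`), by kernel evaluation. -/
theorem rhatCell_6_16_4 : phiK (6 + 16) 6 ≤ rhat 6 16 4 := by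
  simp only [rhat, phiK, mhat, sum_Ioo_nat]
  norm_num [Finset.sum_range_succ, Nat.choose, Nat.min_def]

/-- `Φ(22, 6) ≤ R̂(6, 16, 5)` (the cell `(22, 6)` at `#P = 5`), by kernel evaluation. -/
theorem rhatCell_6_16_5 : phiK (6 + 16) 6 ≤ rhat 6 16 5 := by
  simp only [rhat, phiK, mhat, sum_Ioo_nat]
  norm_num [Finset.sum_range_succ, Nat.choose, Nat.min_def]

/-- `Φ(22, 6) ≤ R̂(6, 16, 6)` (the cell `(22, 6)` at `#P = 6`), by kernel evaluation. -/
theorem rhatCell_6_16_6 : phiK (6 + 16) 6 ≤ rhat 6 16 6 := by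
  simp only [rhat, phiK, mhat, sum_Ioo_nat]
  norm_num [Finset.sum_range_succ, Nat.choose, Nat.min_def]

/-- The cell `(22, 6)` (`q = 6`, `k = 16`): `Φ(22, 6) ≤ R̂(6, 16, m)` for every `m ≤ 6`. -/
theorem rhatCell_6_16 : RhatCell 6 16 := by
  intro m hm
  interval_cases m
  · exact rhatCell_6_16_0
  · exact rhatCell_6_16_1
  · exact rhatCell_6_16_2
  · exact rhatCell_6_16_3
  · exact rhatCell_6_16_4
  · exact rhatCell_6_16_5
  · exact rhatCell_6_16_6

end PercRepro
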